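/-
O(2) `{φ, s, t}` scan: rule (T) (term matrices at the apex) for all seven sectors on a BOX of external
dimensions.
-/
import Literature.MathematicalPhysics.QuantumFieldTheory.O2DimBox
import Literature.MathematicalPhysics.QuantumFieldTheory.O2ChargedSectorsTail
import Literature.MathematicalPhysics.QuantumFieldTheory.O2ChargedSectorsRules
import HarnessLib

/-!
# O(2) `{φ, s, t}` scan: rule (T) on a BOX of external dimensions

Companion of `O2NeutralDimBox` / `O2ChargedDimBox` (rule (M)).  At ONE external point `D` the tree decides
the apex obligations (`E ≥ E_T`, all `j ≤ E`) of every sector from the APEX NUMBERS of its two-weight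
entries at the exponent `s = D.expo L` (or `expoQ D`, `expoW1 D`): the lower number
`apexLoTW(c, d; s, T) = c_a v_a^{s} − apexRadTW(c, d; s, T)` and the absolute number
`apexAbsTW(c, d; s, T) = |c_a| v_a^{s} + apexRadTW(c, d; s, T)` (`O2ChargedSectorsTail` §3; for `0⁺` the
vectors `apexLo0p`, `apexRad0p` of `O2NeutralSectorsTail` §3 are these numbers entrywise).  In `s` every
ingredient is MONOTONE: `v_a = (1 − z_a)(1 − z̄_a) ∈ (0, 1)` so `s ↦ v_a^{s}` is antitone, and the apex
remainder `apexRest` is antitone in the exponent (tree: `apexRest_anti_exponent`).  Hence on a box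
`lo ≤ D ≤ hi` of external dimensions (exponent interval `[s_lo, s_hi]`, `O2DimBox.expo_mem_Icc`):

* `dapexLoTW(c, d; s_lo, s_hi, T) = min(c_a v_a^{s_lo}, c_a v_a^{s_hi}) − apexRadTW(c, d; s_lo, T) ≤ apexLoTW(c, d; s, T)`,
* `apexAbsTW(c, d; s, T) ≤ dapexAbsTW(c, d; s_lo, T) = |c_a| v_a^{s_lo} + apexRadTW(c, d; s_lo, T)`

for every `s ∈ [s_lo, s_hi]` (§1), and every point rule (T) holds UNIFORMLY IN `D` on the box once its
closed-form checks hold for the box numbers (§2–§3): the `1 × 1` sectors `2⁻`, `3`, `4`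
(`twTerm_nonneg_of_apex_on_dbox` and instances), the kernel tests of `2⁺` and `1`
(`kernelTest2p_of_apex_on_dbox`, `kernelTest1_of_apex_on_dbox`), the `2 × 2` sector `0⁻`
(`termMatrix0m_posSemidef_of_apex_on_dbox`) and the `3 × 3` sector `0⁺`
(`termMatrix0p_posSemidef_of_apex_on_dbox`: the sign–radius vertex matrices of the box numbers PSD ⇒ those of
the point numbers PSD at every `D` of the box, by the interval-matrix criterion itself, since the point
numbers lie inside the box numbers).  Same reader-side data shape as the point rules.  (Chester et al. test
finitely many external points and triangulate, §3.3–§3.4; a certificate for a CELL of external dimensions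
needs every rule uniformly on the cell.)
-/

noncomputable section

namespace Literature.MathematicalPhysics.QuantumFieldTheory.O2ApexDimBox

open Set Finset Matrix
open Literature.MathematicalPhysics.QuantumFieldTheory.ConformalBootstrap3D
open O2ThreeScalarCrossing O2ThreeScalarSystem O2OPEScanBridge O2ScanObligations
open O2NeutralSectorsTermwise O2NeutralSectorsHead O2NeutralSectorsCells O2NeutralSectorsTail
open O2ChargedSectorsTermwise O2ChargeTwoEvenTermwise O2ChargeOneTermwise
open O2ChargedSectorsCells O2ChargedSectorsTail O2ChargeFourRules O2ChargedSectorsRules O2DimBox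
open Literature.Analysis.ValidatedNumerics.ParametricIntervalPosSemidef (signRadMatrix signRadMatrix_apply
  posSemidef_of_forall_signRadMatrix)

/-! ## 1. The apex numbers on an exponent interval -/

/-- `v_a = (1 − z_a)(1 − z̄_a) ∈ (0, 1]` for a scan functional's node. [cite: HogervorstRychkov2013, §3 eq. (3.6)] -/
theorem apexBase_pos_le_one (F : ScanFunctional) (a : Fin F.M) :
    0 < (1 - F.z a) * (1 - F.zb a) ∧ (1 - F.z a) * (1 - F.zb a) ≤ 1 :=
  ⟨mul_pos (by linarith [(F.hz a).2]) (by linarith [(F.hzb a).2]),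
    mul_le_one₀ (by linarith [(F.hz a).1]) (by linarith [(F.hzb a).2]) (by linarith [(F.hzb a).1])⟩

/-- `s ↦ c · v_a^{s}` is monotone (one way or the other), so on `[s_lo, s_hi]` it is at least the smaller
endpoint value. [cite: HogervorstRychkov2013, §3 eq. (3.6)] -/
theorem min_endpoints_le_mul_rpow (F : ScanFunctional) (a : Fin F.M) (c : ℝ) {slo shi s : ℝ}
    (hs : s ∈ Icc slo shi) :
    min (c * ((1 - F.z a) * (1 - F.zb a)) ^ slo) (c * ((1 - F.z a) * (1 - F.zb a)) ^ shi) ≤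
      c * ((1 - F.z a) * (1 - F.zb a)) ^ s := by
  have hv := apexBase_pos_le_one F a
  have h1 : ((1 - F.z a) * (1 - F.zb a)) ^ s ≤ ((1 - F.z a) * (1 - F.zb a)) ^ slo :=
    Real.rpow_le_rpow_of_exponent_ge hv.1 hv.2 hs.1
  have h2 : ((1 - F.z a) * (1 - F.zb a)) ^ shi ≤ ((1 - F.z a) * (1 - F.zb a)) ^ s :=
    Real.rpow_le_rpow_of_exponent_ge hv.1 hv.2 hs.2
  rcases le_or_gt 0 c with hc | hc
  · exact (min_le_right _ _).trans (mul_le_mul_of_nonneg_left h2 hc)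
  · exact (min_le_left _ _).trans (by nlinarith)

/-- `|c · v_a^{s}| ≤ |c| · v_a^{s_lo}` for `s ≥ s_lo`. [cite: HogervorstRychkov2013, §3 eq. (3.6)] -/
theorem abs_mul_rpow_le (F : ScanFunctional) (a : Fin F.M) (c : ℝ) {slo s : ℝ} (hs : slo ≤ s) :
    |c * ((1 - F.z a) * (1 - F.zb a)) ^ s| ≤ |c| * ((1 - F.z a) * (1 - F.zb a)) ^ slo := by
  have hv := apexBase_pos_le_one F a
  rw [abs_mul, abs_of_nonneg (Real.rpow_nonneg hv.1.le _)]
  exact mul_le_mul_of_nonneg_left (Real.rpow_le_rpow_of_exponent_ge hv.1 hv.2 hs) (abs_nonneg _)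

/-- The apex radius `apexRadTW(c, d; s, T)` is antitone in the exponent `s` (ratios `qd, qr ≥ 0`).
[cite: HogervorstRychkov2013, §3 eq. (3.6)] -/
theorem apexRadTW_anti_exponent (F : ScanFunctional) (c d : Fin F.M → ℝ) (a : Fin F.M)
    {qd qr : Fin F.M → ℝ} (hqd : ∀ m, 0 ≤ qd m) (hqr : ∀ m, 0 ≤ qr m) {s s' : ℝ} (h : s ≤ s') (T : ℝ) :
    apexRadTW F c d a qd qr s' T ≤ apexRadTW F c d a qd qr s T :=
  add_le_add (apexRest_anti_exponent _ F.z F.zb F.hz F.hzb a qd qr hqd hqr h T)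
    (apexRest_anti_exponent _ F.z F.zb F.hz F.hzb a qd qr hqd hqr h T)

/-- **Box apex lower number** of a two-weight evaluation on the exponent interval `[s_lo, s_hi]`:
`min(c_a v_a^{s_lo}, c_a v_a^{s_hi}) − apexRadTW(c, d; s_lo, T)`. [cite: HogervorstRychkov2013, §3 eq. (3.6)]
[cite: ChesterEtAl2020, §3.3 (scanning over external dimensions)] -/
def dapexLoTW (F : ScanFunctional) (c d : Fin F.M → ℝ) (a : Fin F.M) (qd qr : Fin F.M → ℝ)
    (slo shi T : ℝ) : ℝ :=
  min (c a * ((1 - F.z a) * (1 - F.zb a)) ^ slo) (c a * ((1 - F.z a) * (1 - F.zb a)) ^ shi) -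
    apexRadTW F c d a qd qr slo T

/-- **Box apex absolute number** on the exponent interval `[s_lo, s_hi]` (only `s_lo` enters):
`|c_a| v_a^{s_lo} + apexRadTW(c, d; s_lo, T)`. [cite: HogervorstRychkov2013, §3 eq. (3.6)]
[cite: ChesterEtAl2020, §3.3 (scanning over external dimensions)] -/
def dapexAbsTW (F : ScanFunctional) (c d : Fin F.M → ℝ) (a : Fin F.M) (qd qr : Fin F.M → ℝ)
    (slo T : ℝ) : ℝ :=
  |c a| * ((1 - F.z a) * (1 - F.zb a)) ^ slo + apexRadTW F c d a qd qr slo T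

/-- `dapexLoTW(s_lo, s_hi) ≤ apexLoTW(s)` for `s ∈ [s_lo, s_hi]`. [cite: HogervorstRychkov2013, §3 eq. (3.6)]
[cite: ChesterEtAl2020, §3.3 (scanning over external dimensions)] -/
theorem dapexLoTW_le (F : ScanFunctional) (c d : Fin F.M → ℝ) (a : Fin F.M) {qd qr : Fin F.M → ℝ}
    (hqd : ∀ m, 0 ≤ qd m) (hqr : ∀ m, 0 ≤ qr m) {slo shi s : ℝ} (hs : s ∈ Icc slo shi) (T : ℝ) :
    dapexLoTW F c d a qd qr slo shi T ≤ apexLoTW F c d a qd qr s T :=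
  sub_le_sub (min_endpoints_le_mul_rpow F a (c a) hs) (apexRadTW_anti_exponent F c d a hqd hqr hs.1 T)

/-- `apexAbsTW(s) ≤ dapexAbsTW(s_lo)` for `s ≥ s_lo`. [cite: HogervorstRychkov2013, §3 eq. (3.6)]
[cite: ChesterEtAl2020, §3.3 (scanning over external dimensions)] -/
theorem apexAbsTW_le_dapexAbsTW (F : ScanFunctional) (c d : Fin F.M → ℝ) (a : Fin F.M)
    {qd qr : Fin F.M → ℝ} (hqd : ∀ m, 0 ≤ qd m) (hqr : ∀ m, 0 ≤ qr m) {slo s : ℝ} (hs : slo ≤ s)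
    (T : ℝ) : apexAbsTW F c d a qd qr s T ≤ dapexAbsTW F c d a qd qr slo T :=
  add_le_add (abs_mul_rpow_le F a (c a) hs) (apexRadTW_anti_exponent F c d a hqd hqr hs T)

/-- `0 ≤ apexAbsTW`. [cite: HogervorstRychkov2013, §3 eq. (3.6)] -/
theorem apexAbsTW_nonneg (F : ScanFunctional) (c d : Fin F.M → ℝ) (a : Fin F.M) {qd qr : Fin F.M → ℝ}
    (hqd : ∀ m, 0 ≤ qd m) (hqr : ∀ m, 0 ≤ qr m) (s T : ℝ) : 0 ≤ apexAbsTW F c d a qd qr s T :=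
  add_nonneg (abs_nonneg _)
    (add_nonneg (apexRest_nonneg _ F.z F.zb F.hz F.hzb a qd qr hqd hqr s T)
      (apexRest_nonneg _ F.z F.zb F.hz F.hzb a qd qr hqd hqr s T))

/-- The box closed-form test implies the point closed-form test at every exponent triple of the box:
`X' ≤ X`, `Y' ≤ Y`, `0 ≤ Z ≤ Z'`, `X', Y' ≥ 0`, `Z'² ≤ 4 X' Y'` ⇒ `X, Y ≥ 0`, `Z² ≤ 4 X Y`.
[cite: ChesterEtAl2020, §3.1 ("`M ⪰ 0`")] -/
theorem test_mono {X Y Z X' Y' Z' : ℝ} (hX : X' ≤ X) (hY : Y' ≤ Y) (hZ0 : 0 ≤ Z) (hZ : Z ≤ Z')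
    (h0X : 0 ≤ X') (h0Y : 0 ≤ Y') (hdet : Z' ^ 2 ≤ 4 * X' * Y') :
    0 ≤ X ∧ 0 ≤ Y ∧ Z ^ 2 ≤ 4 * X * Y := by
  refine ⟨h0X.trans hX, h0Y.trans hY, ?_⟩
  calc Z ^ 2 ≤ Z' ^ 2 := by nlinarith
    _ ≤ 4 * X' * Y' := hdet
    _ ≤ 4 * X * Y := by nlinarith [mul_le_mul hX hY h0Y (h0X.trans hX)]

/-! ## 2. The charged sectors at the apex, uniformly on a box of external dimensions -/

section Charged

variable (F : ScanFunctional) (hord : ∀ m, F.zb m ≤ F.z m) (a : Fin F.M) (qd qr : Fin F.M → ℝ)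
  (hqd : ∀ m, 0 < qd m ∧ qd m ≤ 1) (hqr : ∀ m, 0 < qr m ∧ qr m ≤ 1)
  (hdomd : ∀ m, F.z m * F.zb m ≤ qd m ^ 2 * (F.z a * F.zb a) ∧ F.z m ≤ qd m * F.z a)
  (hdomr : ∀ m, (1 - F.z m) * (1 - F.zb m) ≤ qr m ^ 2 * (F.z a * F.zb a) ∧ 1 - F.zb m ≤ qr m * F.z a)
include hord hqd hqr hdomd hdomr

/-- **Rule (T) for a two-weight term, uniform on a box of external dimensions**:
`dapexLoTW(c, d; lo.expo L, hi.expo L, E_T) ≥ 0 ⇒ T(c, d; D.expo L)[𝒫_{E,j}] ≥ 0` for every `D` with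
`lo ≤ D ≤ hi`, every `E ≥ E_T` and `j ≤ E`. [cite: HogervorstRychkov2013, §3 eq. (3.6)]
[cite: ChesterEtAl2020, §3.3 (scanning over external dimensions)] -/
theorem twTerm_nonneg_of_apex_on_dbox (c d : Fin F.M → ℝ) (L : Label) {lo hi : Dims} {ET : ℝ}
    (hapex : 0 ≤ dapexLoTW F c d a qd qr (lo.expo L) (hi.expo L) ET) :
    ∀ D, InDimBox lo hi D → ∀ E : ℝ, ET ≤ E → ∀ j : ℕ, (j : ℝ) ≤ E → 0 ≤ twTerm F c d (D.expo L) E j :=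
  fun D hD => twTerm_nonneg_of_apex F c d (D.expo L) hord a qd qr hqd hqr hdomd hdomr
    (hapex.trans (dapexLoTW_le F c d a (fun m => (hqd m).1.le) (fun m => (hqr m).1.le)
      (expo_mem_Icc hD L) ET))

/-- **Rule (T), sector `2⁻`, uniform on a box of external dimensions.**
[cite: HogervorstRychkov2013, §3 eq. (3.6)] [cite: ChesterEtAl2020, §3.3 (scanning over external dimensions)] -/
theorem dom2mTerm_nonneg_of_apex_on_dbox {lo hi : Dims} {ET : ℝ}
    (hapex : 0 ≤ dapexLoTW F (cWeight2m F) (dWeight2m F) a qd qr (lo.expo .stts) (hi.expo .stts) ET) :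
    ∀ D, InDimBox lo hi D → ∀ E : ℝ, ET ≤ E → ∀ j : ℕ, (j : ℝ) ≤ E → 0 ≤ dom2mTerm F D E j :=
  fun D hD E hE j hj => by
    rw [dom2mTerm_eq_twTerm]
    exact twTerm_nonneg_of_apex_on_dbox F hord a qd qr hqd hqr hdomd hdomr _ _ .stts hapex D hD E hE j hj

/-- **Rule (T), sector `3`, uniform on a box of external dimensions.**
[cite: HogervorstRychkov2013, §3 eq. (3.6)] [cite: ChesterEtAl2020, §3.3 (scanning over external dimensions)] -/
theorem dom3Term_nonneg_of_apex_on_dbox {lo hi : Dims} {ET : ℝ}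
    (hapex : 0 ≤ dapexLoTW F (cWeight3 F) (dWeight3 F) a qd qr (lo.expo .φttφ) (hi.expo .φttφ) ET) :
    ∀ D, InDimBox lo hi D → ∀ E : ℝ, ET ≤ E → ∀ j : ℕ, (j : ℝ) ≤ E → 0 ≤ dom3Term F D E j :=
  fun D hD E hE j hj => by
    rw [dom3Term_eq_twTerm]
    exact twTerm_nonneg_of_apex_on_dbox F hord a qd qr hqd hqr hdomd hdomr _ _ .φttφ hapex D hD E hE j hj

/-- **Rule (T), sector `4`, uniform on a box of external dimensions.**
[cite: HogervorstRychkov2013, §3 eqs. (3.6), (3.9)] [cite: ChesterEtAl2020, §3.3 (scanning over external dimensions)] -/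
theorem sector4Term_nonneg_of_apex_on_dbox {lo hi : Dims} {ET : ℝ}
    (hapex : 0 ≤ dapexLoTW F (cWeight4 F) (dWeight4 F) a qd qr (lo.expo .tttt) (hi.expo .tttt) ET) :
    ∀ D, InDimBox lo hi D → ∀ E : ℝ, ET ≤ E → ∀ j : ℕ, (j : ℝ) ≤ E → 0 ≤ sector4Term F D E j :=
  fun D hD E hE j hj => by
    rw [sector4Term_eq_twoWeightEval]
    exact twTerm_nonneg_of_apex_on_dbox F hord a qd qr hqd hqr hdomd hdomr _ _ .tttt hapex D hD E hE j hj

/-- **Rule (T), sector `2⁺`, uniform on a box of external dimensions**: the box apex numbers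
`X' = dapexLoTW(c_P, d_P; [lo.Δφ, hi.Δφ])`, `Y' = dapexLoTW(c₂, d₂; [s_{stts}(lo), s_{stts}(hi)])`,
`Z' = dapexAbsTW(c_Q, d_Q; expoQ lo)` at `E_T` with `X', Y' ≥ 0`, `Z'² ≤ 4 X' Y'` give the `2⁺` kernel test
at every `D` of the box, every `E ≥ E_T`, `j ≤ E`. [cite: HogervorstRychkov2013, §3 eqs. (3.6), (3.9)]
[cite: ChesterEtAl2020, §3.3 (scanning over external dimensions)] -/
theorem kernelTest2p_of_apex_on_dbox {lo hi : Dims} {ET : ℝ}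
    (hX : 0 ≤ dapexLoTW F (cwP F) (dwP F) a qd qr (lo.expo .φφφφ) (hi.expo .φφφφ) ET)
    (hY : 0 ≤ dapexLoTW F (cWeight2m F) (dWeight2m F) a qd qr (lo.expo .stts) (hi.expo .stts) ET)
    (hdet : dapexAbsTW F (cwQ F) (dwQ F) a qd qr (expoQ lo) ET ^ 2 ≤
      4 * dapexLoTW F (cwP F) (dwP F) a qd qr (lo.expo .φφφφ) (hi.expo .φφφφ) ET *
        dapexLoTW F (cWeight2m F) (dWeight2m F) a qd qr (lo.expo .stts) (hi.expo .stts) ET) :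
    ∀ D, InDimBox lo hi D → ∀ E : ℝ, ET ≤ E → ∀ j : ℕ, (j : ℝ) ≤ E → kernelTest2p F D E j := by
  intro D hD
  have hqd' : ∀ m, 0 ≤ qd m := fun m => (hqd m).1.le
  have hqr' : ∀ m, 0 ≤ qr m := fun m => (hqr m).1.le
  have hQ : expoQ lo ≤ expoQ D := by
    obtain ⟨⟨hs1, hs2⟩, ⟨hp1, hp2⟩, ⟨ht1, ht2⟩⟩ := hD
    simp only [expoQ, Dims.expo]; linarith
  obtain ⟨h1, h2, h3⟩ := test_mono
    (dapexLoTW_le F (cwP F) (dwP F) a hqd' hqr' (expo_mem_Icc hD .φφφφ) ET)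
    (dapexLoTW_le F (cWeight2m F) (dWeight2m F) a hqd' hqr' (expo_mem_Icc hD .stts) ET)
    (apexAbsTW_nonneg F (cwQ F) (dwQ F) a hqd' hqr' (expoQ D) ET)
    (apexAbsTW_le_dapexAbsTW F (cwQ F) (dwQ F) a hqd' hqr' hQ ET) hX hY hdet
  exact kernelTest2p_of_apex F D hord a qd qr hqd hqr hdomd hdomr h1 h2 h3

/-- **Rule (T), sector `1`, uniform on a box of external dimensions** (certificate constant `κ`).
[cite: HogervorstRychkov2013, §3 eqs. (3.6), (3.9)] [cite: ChesterEtAl2020, §3.3 (scanning over external dimensions)] -/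
theorem kernelTest1_of_apex_on_dbox (κ : ℝ) {lo hi : Dims} {ET : ℝ}
    (hX : 0 ≤ dapexLoTW F (cWeightX1 F κ) (dWeightX1 F κ) a qd qr (lo.expo .sφφs) (hi.expo .sφφs) ET)
    (hY : 0 ≤ dapexLoTW F (cWeightY1 F κ) (dWeightY1 F κ) a qd qr (lo.expo .φttφ) (hi.expo .φttφ) ET)
    (hdet : dapexAbsTW F (cwW1 F) (cwW1 F) a qd qr (expoW1 lo) ET ^ 2 ≤
      4 * dapexLoTW F (cWeightX1 F κ) (dWeightX1 F κ) a qd qr (lo.expo .sφφs) (hi.expo .sφφs) ET *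
        dapexLoTW F (cWeightY1 F κ) (dWeightY1 F κ) a qd qr (lo.expo .φttφ) (hi.expo .φttφ) ET) :
    ∀ D, InDimBox lo hi D → ∀ E : ℝ, ET ≤ E → ∀ j : ℕ, (j : ℝ) ≤ E → kernelTest1 F D κ E j := by
  intro D hD
  have hqd' : ∀ m, 0 ≤ qd m := fun m => (hqd m).1.le
  have hqr' : ∀ m, 0 ≤ qr m := fun m => (hqr m).1.le
  have hW : expoW1 lo ≤ expoW1 D := by
    obtain ⟨⟨hs1, hs2⟩, ⟨hp1, hp2⟩, ⟨ht1, ht2⟩⟩ := hD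
    simp only [expoW1, Dims.expo]; linarith
  obtain ⟨h1, h2, h3⟩ := test_mono
    (dapexLoTW_le F (cWeightX1 F κ) (dWeightX1 F κ) a hqd' hqr' (expo_mem_Icc hD .sφφs) ET)
    (dapexLoTW_le F (cWeightY1 F κ) (dWeightY1 F κ) a hqd' hqr' (expo_mem_Icc hD .φttφ) ET)
    (apexAbsTW_nonneg F (cwW1 F) (cwW1 F) a hqd' hqr' (expoW1 D) ET)
    (apexAbsTW_le_dapexAbsTW F (cwW1 F) (cwW1 F) a hqd' hqr' hW ET) hX hY hdet
  exact kernelTest1_of_apex F D κ hord a qd qr hqd hqr hdomd hdomr h1 h2 h3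

end Charged

/-! ## 3. The neutral sectors at the apex, uniformly on a box of external dimensions -/

section Neutral

variable (F : ScanFunctional) (hord : ∀ m, F.zb m ≤ F.z m) (a : Fin F.M) (qd qr : Fin F.M → ℝ)
  (hqd : ∀ m, 0 < qd m ∧ qd m ≤ 1) (hqr : ∀ m, 0 < qr m ∧ qr m ≤ 1)
  (hdomd : ∀ m, F.z m * F.zb m ≤ qd m ^ 2 * (F.z a * F.zb a) ∧ F.z m ≤ qd m * F.z a)
  (hdomr : ∀ m, (1 - F.z m) * (1 - F.zb m) ≤ qr m ^ 2 * (F.z a * F.zb a) ∧ 1 - F.zb m ≤ qr m * F.z a)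

/-- `Z ≤ Z'`, `0 ≤ Z`, `X' ≤ X`, `Y' ≤ Y`, `X', Y' ≥ 0`, `Z'² ≤ X' Y'` ⇒ `Z² ≤ X Y` (and `X, Y ≥ 0`).
[cite: HogervorstRychkov2013, §3 eq. (3.6)] -/
theorem sq_le_mul_mono {X Y Z X' Y' Z' : ℝ} (hX : X' ≤ X) (hY : Y' ≤ Y) (hZ0 : 0 ≤ Z) (hZ : Z ≤ Z')
    (h0X : 0 ≤ X') (h0Y : 0 ≤ Y') (hdet : Z' ^ 2 ≤ X' * Y') : Z ^ 2 ≤ X * Y :=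
  calc Z ^ 2 ≤ Z' ^ 2 := by nlinarith
    _ ≤ X' * Y' := hdet
    _ ≤ X * Y := mul_le_mul hX hY h0Y (h0X.trans hX)

/-- **Box apex lower numbers of the diagonal `0⁺` entries** (exponent intervals of the box).
[cite: HogervorstRychkov2013, §3 eq. (3.6)] [cite: ChesterEtAl2020, §3.3 (scanning over external dimensions)] -/
def dapexLo0p (lo hi : Dims) (T : ℝ) : Fin 3 → ℝ := fun i =>
  dapexLoTW F (cw0p F i i) (dw0p F i i) a qd qr (lo.expo (lab0p i i)) (hi.expo (lab0p i i)) T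

/-- **Box apex radius numbers of the `0⁺` entries** (lower exponent corner of the box).
[cite: HogervorstRychkov2013, §3 eq. (3.6)] [cite: ChesterEtAl2020, §3.3 (scanning over external dimensions)] -/
def dapexRad0p (lo : Dims) (T : ℝ) : Matrix (Fin 3) (Fin 3) ℝ := Matrix.of fun i k =>
  dapexAbsTW F (cw0p F i k) (dw0p F i k) a qd qr (lo.expo (lab0p i k)) T

/-- The `0⁺` weights and labels are symmetric in `(i, k)`.
[cite: ChesterEtAl2020, App. «Crossing vectors» (`V⃗_{0⁺,Δ,ℓ⁺}`)] -/
theorem cw0p_dw0p_lab0p_symm (i k : Fin 3) :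
    cw0p F i k = cw0p F k i ∧ dw0p F i k = dw0p F k i ∧ lab0p i k = lab0p k i := by
  refine ⟨funext fun m => ?_, funext fun m => ?_, ?_⟩ <;>
    fin_cases i <;> fin_cases k <;> simp [cw0p, dw0p, lab0p]

/-- The point apex radius matrix of `0⁺` is symmetric. [cite: HogervorstRychkov2013, §3 eq. (3.6)] -/
theorem isHermitian_apexRad0p (D : Dims) (T : ℝ) : (apexRad0p F D a qd qr T).IsHermitian := by
  refine Matrix.IsHermitian.ext fun i k => ?_
  obtain ⟨hc, hd, hl⟩ := cw0p_dw0p_lab0p_symm F k i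
  simp only [star_trivial, apexRad0p, Matrix.of_apply, hc, hd, hl]

include hord hqd hqr hdomd hdomr

/-- **Rule (T), sector `0⁺`, uniform on a box of external dimensions.** In the dominated node
configuration, if the sign–radius vertex matrices of the BOX apex numbers `(dapexLo0p lo hi E_T,
dapexRad0p lo E_T)` are PSD then `M^{0+}_D(E, j)` is PSD for every `D` with `lo ≤ D ≤ hi`, every `E ≥ E_T`
and every `j ≤ E` — because the point apex numbers at `D` lie inside the box numbers, so each point vertex
matrix is itself PSD by the interval-matrix criterion. [cite: HogervorstRychkov2013, §3 eq. (3.6)]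
[cite: Hladik2017, Thm. 1 ((2) ⇒ (1))] [cite: ChesterEtAl2020, §3.3 (scanning over external dimensions)] -/
theorem termMatrix0p_posSemidef_of_apex_on_dbox {lo hi : Dims} {ET : ℝ}
    (hvert : ∀ z : Fin 3 → Bool,
      (signRadMatrix (dapexLo0p F a qd qr lo hi ET) (dapexRad0p F a qd qr lo ET) z).PosSemidef) :
    ∀ D, InDimBox lo hi D → ∀ E : ℝ, ET ≤ E → ∀ j : ℕ, (j : ℝ) ≤ E → (termMatrix0p F D E j).PosSemidef := by
  intro D hD
  have hqd' : ∀ m, 0 ≤ qd m := fun m => (hqd m).1.le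
  have hqr' : ∀ m, 0 ≤ qr m := fun m => (hqr m).1.le
  refine termMatrix0p_posSemidef_of_apex F D hord a qd qr hqd hqr hdomd hdomr fun z => ?_
  refine posSemidef_of_forall_signRadMatrix hvert
    (Literature.Analysis.ValidatedNumerics.ParametricIntervalPosSemidef.isHermitian_signRadMatrix _
      (isHermitian_apexRad0p F a qd qr D ET) z) (fun i => ?_) (fun i k hik => ?_)
  · simp only [signRadMatrix_apply, dapexLo0p, apexLo0p]
    exact dapexLoTW_le F _ _ a hqd' hqr' (expo_mem_Icc hD _) ET
  · simp only [signRadMatrix_apply, if_neg hik, dapexRad0p, Matrix.of_apply]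
    have hR : apexRad0p F D a qd qr ET i k ≤
        dapexAbsTW F (cw0p F i k) (dw0p F i k) a qd qr (lo.expo (lab0p i k)) ET :=
      apexAbsTW_le_dapexAbsTW F _ _ a hqd' hqr' (expo_mem_Icc hD (lab0p i k)).1 ET
    have hR0 : 0 ≤ apexRad0p F D a qd qr ET i k :=
      apexAbsTW_nonneg F (cw0p F i k) (dw0p F i k) a hqd' hqr' (D.expo (lab0p i k)) ET
    split_ifs
    · rw [abs_neg, abs_of_nonneg hR0]; exact hR
    · rw [abs_of_nonneg hR0]; exact hR

/-- **Rule (T), sector `0⁻`, uniform on a box of external dimensions** (closed form): with the box numbers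
`X' = dapexLoTW(c₀₀, d₀₀; [lo, hi].expo s₀₀, E_T)`, `Y' = dapexLoTW(c₁₁, d₁₁; …)`,
`Z' = dapexAbsTW(c₀₁, d₀₁; lo.expo s₀₁, E_T)`, the checks `X', Y' ≥ 0`, `Z'² ≤ X' Y'` give `M^{0−}_D(E, j)` PSD
for every `D` with `lo ≤ D ≤ hi`, every `E ≥ E_T`, `j ≤ E`. [cite: HogervorstRychkov2013, §3 eq. (3.6)]
[cite: ChesterEtAl2020, §3.3 (scanning over external dimensions)] -/
theorem termMatrix0m_posSemidef_of_apex_on_dbox {lo hi : Dims} {ET : ℝ}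
    (hX : 0 ≤ dapexLoTW F (cw0m F 0 0) (dw0m F 0 0) a qd qr (lo.expo (lab0m 0 0)) (hi.expo (lab0m 0 0)) ET)
    (hY : 0 ≤ dapexLoTW F (cw0m F 1 1) (dw0m F 1 1) a qd qr (lo.expo (lab0m 1 1)) (hi.expo (lab0m 1 1)) ET)
    (hZ : dapexAbsTW F (cw0m F 0 1) (dw0m F 0 1) a qd qr (lo.expo (lab0m 0 1)) ET ^ 2 ≤
      dapexLoTW F (cw0m F 0 0) (dw0m F 0 0) a qd qr (lo.expo (lab0m 0 0)) (hi.expo (lab0m 0 0)) ET *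
        dapexLoTW F (cw0m F 1 1) (dw0m F 1 1) a qd qr (lo.expo (lab0m 1 1)) (hi.expo (lab0m 1 1)) ET) :
    ∀ D, InDimBox lo hi D → ∀ E : ℝ, ET ≤ E → ∀ j : ℕ, (j : ℝ) ≤ E → (termMatrix0m F D E j).PosSemidef := by
  intro D hD
  have hqd' : ∀ m, 0 ≤ qd m := fun m => (hqd m).1.le
  have hqr' : ∀ m, 0 ≤ qr m := fun m => (hqr m).1.le
  have h00 := dapexLoTW_le F (cw0m F 0 0) (dw0m F 0 0) a hqd' hqr' (expo_mem_Icc hD (lab0m 0 0)) ET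
  have h11 := dapexLoTW_le F (cw0m F 1 1) (dw0m F 1 1) a hqd' hqr' (expo_mem_Icc hD (lab0m 1 1)) ET
  have h01 := apexAbsTW_le_dapexAbsTW F (cw0m F 0 1) (dw0m F 0 1) a hqd' hqr'
    (expo_mem_Icc hD (lab0m 0 1)).1 ET
  have h01' := apexAbsTW_nonneg F (cw0m F 0 1) (dw0m F 0 1) a hqd' hqr' (D.expo (lab0m 0 1)) ET
  have hZD := sq_le_mul_mono h00 h11 h01' h01 hX hY hZ
  exact termMatrix0m_posSemidef_of_apex F D hord a qd qr hqd hqr hdomd hdomr (hX.trans h00) (hY.trans h11)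
    hZD

end Neutral

end Literature.MathematicalPhysics.QuantumFieldTheory.O2ApexDimBox
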